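import Mathlib.Algebra.Algebra.Hom
import Mathlib.Algebra.Algebra.Tower
import Mathlib.LinearAlgebra.Span.Basic
import Mathlib.RingTheory.Ideal.Maps
import Mathlib.Algebra.Algebra.Operations
import HarnessLib

/-!
# Route `RamifiedHeegnerPair`, crux U₁ `LeafRankOneUpperAtThree` (stmt-BirchSwinnertonDyer-26022), line `partnerdescent` —
# partner kernel: the EIGENCHARACTER of a common eigenvector, and density of the cosocle condition (inputs `χ`, `hχt`, `hmult` of the local run)

HONEST FRAMING. Theorems only; helper file (`--supports stmt-BirchSwinnertonDyer-26022 --as helper`); pure algebra over Mathlib; no number theory,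
no named fact, no `sorry`; nothing booked; BSD is proved for no curve. Lead prover bsd-line-rhp-p2 g63, 2026-08-31. Serves the BASE CHANGE layer
(α) of LEAD-G63-ASSEMBLY.md §4b: three of the hypotheses of `LeafPartnerOrders.dvd_of_localRun` (‹…LeafPartnerOrdersLocalRun›) are produced here
from data the integral Brandt set-up provides directly.

* `exists_eigencharacter` — for an `R`-algebra `A` acting on an `R`-torsion-free module `M` and a COMMON EIGENVECTOR `g ≠ 0` (`A·g ⊆ R·g`), there
  is an `R`-algebra map `χ : A →ₐ[R] R` with `s·g = χ(s)·g` (the eigencharacter; in the derivation `g` = the primitive generator of Takahashi's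
  `f`-line `L = ℤg` in the Brandt module, `χ = χ_f`, and `𝔫 := χ⁻¹(𝔪_R)` is the maximal ideal `𝔪_{f,3}` of `𝕋̂` — hypothesis `h𝔫` of the run is
  then `Ideal.mem_comap`).
* `mul_eq_smul_of_range_le_line` — if moreover `A` acts faithfully and `t ∈ A` maps `M` into the line `R·g` (`t = N·e_f`, the `f`-projector
  with its Hecke denominator: `t x = (N/ξ)⟨g, x⟩·g`), then `s·t = χ(s)·t` in `A` — hypothesis `hχt` of the run.
* `forall_exists_sub_smul_mem_of_span` — DENSITY of the cosocle condition: if the vectors of a spanning set are `c·x₀` modulo `𝔫·M`, so is every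
  vector — hypothesis `hmult` of the run from the typed (C3′) on the integral Brandt module (`B̂ = ℤ₃`-span of `B`).

[cite: BourbakiAlgebraI1989, Ch. II §1 no. 11; Ch. III §1] [cite: Matsumura1987, Thm. 2.3]
-/

set_option linter.dupNamespace false
set_option autoImplicit false

noncomputable section

namespace Summit.BirchSwinnertonDyer.BirchSwinnertonDyer.Theorems.LeafPartnerOrders

section Eigencharacter

variable {R : Type*} [CommRing R] {A : Type*} [CommRing A] [Algebra R A]
  {M : Type*} [AddCommGroup M] [Module R M] [Module A M] [IsScalarTower R A M]

/-- **The eigencharacter of a common eigenvector.** If `M` is `R`-torsion-free (`r·m = 0 ⟹ r = 0 ∨ m = 0`), `g ≠ 0`, and every `s ∈ A`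
acts on `g` by SOME scalar of `R`, then there is an `R`-ALGEBRA HOMOMORPHISM `χ : A → R` with `s·g = χ(s)·g` for all `s` (the scalar is unique;
multiplicativity from `(ss′)g = s(χ(s′)g)`). In the derivation: `A = 𝕋̂` acting on `B̂`, `g` the generator of the `f`-eigenline (common eigenvector of
every chosen Brandt operator, eigenvalues `a_n(f)`), `χ = χ_f`; the maximal ideal of the run is `𝔫 = χ⁻¹(𝔪_{ℤ₃})`.
[cite: BourbakiAlgebraI1989, Ch. II §1 no. 11 (annihilators), Ch. III §1 (algebra morphisms)] -/
theorem exists_eigencharacter (htf : ∀ (r : R) (m : M), r • m = 0 → r = 0 ∨ m = 0) {g : M} (hg : g ≠ 0)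
    (hline : ∀ s : A, ∃ c : R, s • g = c • g) :
    ∃ χ : A →ₐ[R] R, ∀ s : A, s • g = χ s • g := by
  classical
  -- uniqueness of the scalar
  have huniq : ∀ c c' : R, c • g = c' • g → c = c' := by
    intro c c' h
    have h0 : (c - c') • g = 0 := by rw [sub_smul, h, sub_self]
    rcases htf _ _ h0 with h1 | h1
    · exact sub_eq_zero.mp h1
    · exact absurd h1 hg
  choose χ₀ hχ₀ using hline
  have hmul : ∀ s s' : A, χ₀ (s * s') = χ₀ s * χ₀ s' := by
    intro s s'
    apply huniq
    rw [← hχ₀, mul_smul, hχ₀ s', smul_comm, hχ₀ s, smul_smul, mul_comm]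
  have hone : χ₀ 1 = 1 := huniq _ _ (by rw [← hχ₀, one_smul, one_smul])
  have hadd : ∀ s s' : A, χ₀ (s + s') = χ₀ s + χ₀ s' := by
    intro s s'
    apply huniq
    rw [← hχ₀, add_smul, hχ₀, hχ₀, add_smul]
  have hzero : χ₀ 0 = 0 := huniq _ _ (by rw [← hχ₀, zero_smul, zero_smul])
  have hcomm : ∀ r : R, χ₀ (algebraMap R A r) = r := fun r ↦
    huniq _ _ (by rw [← hχ₀, algebraMap_smul])
  let χ : A →ₐ[R] R :=
    { toFun := χ₀
      map_one' := hone
      map_mul' := hmul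
      map_zero' := hzero
      map_add' := hadd
      commutes' := fun r ↦ by rw [hcomm]; rfl }
  exact ⟨χ, fun s ↦ hχ₀ s⟩

/-- **`s·t = χ(s)·t` for an operator `t` with range in the eigenline.** If `A` acts faithfully on `M`, `χ` is the eigencharacter of `g`
(`s·g = χ(s)·g`), and `t ∈ A` maps every vector into the line `R·g` (`t·x = c_x·g`), then `s * t = χ(s) • t` in `A`. In the derivation
`t = N·e_f` (`t x = (N/ξ)⟨g, x⟩ g`): the hypothesis `hχt` of `dvd_of_localRun`. [cite: BourbakiAlgebraI1989, Ch. II §1 no. 11] -/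
theorem mul_eq_smul_of_range_le_line (hfaith : ∀ s : A, (∀ m : M, s • m = 0) → s = 0) (χ : A →ₐ[R] R) {g : M}
    (hχ : ∀ s : A, s • g = χ s • g) {t : A} (ht : ∀ x : M, ∃ c : R, t • x = c • g) (s : A) : s * t = χ s • t := by
  have h : ∀ m : M, (s * t - χ s • t) • m = 0 := by
    intro m
    obtain ⟨c, hc⟩ := ht m
    rw [sub_smul, mul_smul, hc, smul_comm s c g, hχ s, smul_assoc, hc, smul_comm, sub_self]
  exact sub_eq_zero.mp (hfaith _ h)

end Eigencharacter

section Density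

variable {R : Type*} [CommRing R] {A : Type*} [CommRing A] [Algebra R A]
  {M : Type*} [AddCommGroup M] [Module R M] [Module A M] [IsScalarTower R A M]

/-- **Density of the cosocle condition.** If every vector of a set `S` spanning `M` over `R` is congruent to an `A`-multiple of `x₀` modulo
`𝔫·M`, then so is EVERY vector of `M` (the vectors with this property form an `R`-submodule). In the derivation: `S` = the integral Brandt
vectors of degree zero spanning `B̂ = ℤ₃ ⊗ B`, `𝔫 = 𝔪_{f,3}` (`∋ 3` and `∋ T(n) − a_n`), so the typed (C3′) «`x − c·x₀ ∈ 3B + Σ (T(n) − a_n)B`» gives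
the hypothesis `hmult` of `dvd_of_localRun`. [cite: Matsumura1987, Thm. 2.3 (the form of Nakayama's hypothesis)] -/
theorem forall_exists_sub_smul_mem_of_span (𝔫 : Ideal A) (x₀ : M) {S : Set M} (hS : Submodule.span R S = ⊤)
    (h : ∀ b ∈ S, ∃ c : A, b - c • x₀ ∈ 𝔫 • (⊤ : Submodule A M)) :
    ∀ x : M, ∃ c : A, x - c • x₀ ∈ 𝔫 • (⊤ : Submodule A M) := by
  intro x
  have hx : x ∈ Submodule.span R S := hS ▸ Submodule.mem_top
  induction hx using Submodule.span_induction with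
  | mem b hb => exact h b hb
  | zero => exact ⟨0, by rw [zero_smul, sub_zero]; exact Submodule.zero_mem _⟩
  | add y z _ _ hy hz =>
      obtain ⟨c, hc⟩ := hy
      obtain ⟨c', hc'⟩ := hz
      refine ⟨c + c', ?_⟩
      have : y + z - (c + c') • x₀ = (y - c • x₀) + (z - c' • x₀) := by rw [add_smul]; abel
      rw [this]
      exact Submodule.add_mem _ hc hc'
  | smul r y _ hy =>
      obtain ⟨c, hc⟩ := hy
      refine ⟨algebraMap R A r * c, ?_⟩
      have : r • y - (algebraMap R A r * c) • x₀ = r • (y - c • x₀) := by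
        rw [mul_smul, algebraMap_smul, smul_sub]
      rw [this]
      exact Submodule.smul_of_tower_mem _ r hc

end Density

end Summit.BirchSwinnertonDyer.BirchSwinnertonDyer.Theorems.LeafPartnerOrders

end
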